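import Summits.Ventures.PackingBounds.ThreePointCert.T28Proof
import Summits.Ventures.PackingBounds.ThreePointCert.T29Proof
import Summits.Ventures.PackingBounds.SphericalCodes.TammesReading
import Summits.Ventures.PackingBounds.Configurations.TammesConfigsC

/-!
# Tammes problem, `N = 28, 29`: angle readings and two-sided kernel brackets

Framing: lottery ticket; floor = certified bounds/negative ranges. Venture `PackingBounds`
(cell `pub-packcert`), spherical-codes family, table B2b (Tammes) rows `N = 28, 29`.

The tree holds the kernel-checked Bachoc–Vallentin three-point certificates
`ThreePointCert.T28.tammes28_card_le_27_sdp` (`s = 1889/2500`, exact bound value `27.746398 < 28`) and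
`ThreePointCert.T29.tammes29_card_le_28_sdp` (`s = 3819/5000`, exact bound value `28.892216 < 29`)
(`n = 3`, degree 10, Bachoc–Vallentin's multiplier set, Chebyshev kernels on `S²`).  This file READS them in
Tammes form (pattern of `TammesEighteen.lean` / `TammesNineteenToTwentySeven.lean`): among any `N` or more points
of `S²` two distinct ones make an angle `< arccos s_N`, so `θ(N) < arccos s_N` (`40.9222…°` for `N = 28`,
`40.1996…°` for `N = 29`); each reading is paired with the explicit `N`-point configuration of
`Config.TammesConfigsC` (`Config.Tammes.exists_code_N`, best configuration known, angles `39.3551…°` /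
`38.7136…°`) into one kernel statement.  A certified bound per row, not a configuration and not an optimality
claim; the print comparison (classical Fejes Tóth 1943 bound; no semidefinite bound printed for these `N`) is
carried by the cell's table.

## References
* C. Bachoc, F. Vallentin, New upper bounds for kissing numbers from semidefinite programming,
  J. Amer. Math. Soc. 21 (2008), Theorem 4.2. [`BachocVallentin2007`]
-/

noncomputable section

open Finset
open scoped RealInnerProductSpace

namespace Summit.Ventures.PackingBounds.SphericalCodes

/-- **Tammes `N = 28`, inner products**: among any `28` or more unit vectors of `ℝ³`, two distinct ones
have inner product `> 1889/2500`. -/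
theorem tammes28_exists_inner_gt (C : Finset (EuclideanSpace ℝ (Fin 3)))
    (h1 : ∀ x ∈ C, ‖x‖ = 1) (hC : 27 < C.card) :
    ∃ x ∈ C, ∃ y ∈ C, x ≠ y ∧ (1889 / 2500 : ℝ) < inner ℝ x y :=
  exists_inner_gt_of_codeBound ThreePointCert.T28.tammes28_card_le_27_sdp C h1 hC

/-- **Tammes `N = 28`, angles**: among any `28` or more unit vectors of `ℝ³`, two distinct ones make an
(unoriented) angle `< arccos(1889/2500)` (`= 40.9222…°`). -/
theorem tammes28_exists_angle_lt_arccos (C : Finset (EuclideanSpace ℝ (Fin 3)))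
    (h1 : ∀ x ∈ C, ‖x‖ = 1) (hC : 27 < C.card) :
    ∃ x ∈ C, ∃ y ∈ C, x ≠ y ∧ InnerProductGeometry.angle x y < Real.arccos (1889 / 2500) :=
  exists_angle_lt_arccos_of_codeBound ThreePointCert.T28.tammes28_card_le_27_sdp
    (by norm_num) C h1 hC

/-- **`θ(28) < arccos(1889/2500)`**: any common lower bound `θ` for the pairwise angles of `28` or more
unit vectors of `ℝ³` satisfies `θ < arccos(1889/2500)`. -/
theorem tammes28_minAngle_lt_arccos (C : Finset (EuclideanSpace ℝ (Fin 3)))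
    (h1 : ∀ x ∈ C, ‖x‖ = 1) (hC : 27 < C.card) (θ : ℝ)
    (hθ : ∀ x ∈ C, ∀ y ∈ C, x ≠ y → θ ≤ InnerProductGeometry.angle x y) :
    θ < Real.arccos (1889 / 2500) :=
  minAngle_lt_arccos_of_codeBound ThreePointCert.T28.tammes28_card_le_27_sdp
    (by norm_num) C h1 hC θ hθ

/-- **Kernel bracket for the 28-point Tammes problem** (both sides in the tree): there ARE 28 unit vectors of
`ℝ³` with all pairwise inner products `≤ 77323033/10⁸` (`Config.Tammes.exists_code_28`, the best
configuration known, angle `39.3551…°`), and among ANY 28 unit vectors two distinct ones have inner product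
`> 1889/2500` (angle `< 40.9222…°`). In Tammes terms: `39.3551…° ≤ θ(28) < 40.9222…°`. -/
theorem tammes28_bracket :
    (∃ C : Finset (EuclideanSpace ℝ (Fin 3)), C.card = 28 ∧ (∀ x ∈ C, ‖x‖ = 1) ∧
      ∀ x ∈ C, ∀ y ∈ C, x ≠ y → inner ℝ x y ≤ (77323033 : ℝ) / 100000000) ∧
    ∀ C : Finset (EuclideanSpace ℝ (Fin 3)), (∀ x ∈ C, ‖x‖ = 1) → 27 < C.card →
      ∃ x ∈ C, ∃ y ∈ C, x ≠ y ∧ (1889 / 2500 : ℝ) < inner ℝ x y :=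
  ⟨Config.Tammes.exists_code_28, fun C h1 hC => tammes28_exists_inner_gt C h1 hC⟩

/-- **Tammes `N = 29`, inner products**: among any `29` or more unit vectors of `ℝ³`, two distinct ones
have inner product `> 3819/5000`. -/
theorem tammes29_exists_inner_gt (C : Finset (EuclideanSpace ℝ (Fin 3)))
    (h1 : ∀ x ∈ C, ‖x‖ = 1) (hC : 28 < C.card) :
    ∃ x ∈ C, ∃ y ∈ C, x ≠ y ∧ (3819 / 5000 : ℝ) < inner ℝ x y :=
  exists_inner_gt_of_codeBound ThreePointCert.T29.tammes29_card_le_28_sdp C h1 hC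

/-- **Tammes `N = 29`, angles**: among any `29` or more unit vectors of `ℝ³`, two distinct ones make an
(unoriented) angle `< arccos(3819/5000)` (`= 40.1996…°`). -/
theorem tammes29_exists_angle_lt_arccos (C : Finset (EuclideanSpace ℝ (Fin 3)))
    (h1 : ∀ x ∈ C, ‖x‖ = 1) (hC : 28 < C.card) :
    ∃ x ∈ C, ∃ y ∈ C, x ≠ y ∧ InnerProductGeometry.angle x y < Real.arccos (3819 / 5000) :=
  exists_angle_lt_arccos_of_codeBound ThreePointCert.T29.tammes29_card_le_28_sdp
    (by norm_num) C h1 hC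

/-- **`θ(29) < arccos(3819/5000)`**: any common lower bound `θ` for the pairwise angles of `29` or more
unit vectors of `ℝ³` satisfies `θ < arccos(3819/5000)`. -/
theorem tammes29_minAngle_lt_arccos (C : Finset (EuclideanSpace ℝ (Fin 3)))
    (h1 : ∀ x ∈ C, ‖x‖ = 1) (hC : 28 < C.card) (θ : ℝ)
    (hθ : ∀ x ∈ C, ∀ y ∈ C, x ≠ y → θ ≤ InnerProductGeometry.angle x y) :
    θ < Real.arccos (3819 / 5000) :=
  minAngle_lt_arccos_of_codeBound ThreePointCert.T29.tammes29_card_le_28_sdp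
    (by norm_num) C h1 hC θ hθ

/-- **Kernel bracket for the 29-point Tammes problem** (both sides in the tree): there ARE 29 unit vectors of
`ℝ³` with all pairwise inner products `≤ 78028145/10⁸` (`Config.Tammes.exists_code_29`, the best
configuration known, angle `38.7136…°`), and among ANY 29 unit vectors two distinct ones have inner product
`> 3819/5000` (angle `< 40.1996…°`). In Tammes terms: `38.7136…° ≤ θ(29) < 40.1996…°`. -/
theorem tammes29_bracket :
    (∃ C : Finset (EuclideanSpace ℝ (Fin 3)), C.card = 29 ∧ (∀ x ∈ C, ‖x‖ = 1) ∧
      ∀ x ∈ C, ∀ y ∈ C, x ≠ y → inner ℝ x y ≤ (78028145 : ℝ) / 100000000) ∧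
    ∀ C : Finset (EuclideanSpace ℝ (Fin 3)), (∀ x ∈ C, ‖x‖ = 1) → 28 < C.card →
      ∃ x ∈ C, ∃ y ∈ C, x ≠ y ∧ (3819 / 5000 : ℝ) < inner ℝ x y :=
  ⟨Config.Tammes.exists_code_29, fun C h1 hC => tammes29_exists_inner_gt C h1 hC⟩

end Summit.Ventures.PackingBounds.SphericalCodes

end
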